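/-
Copyright: pub-rosobs cell (Resolution Observatory), carver gen 44.  Companion file; statements OURS, in
the cell's polynomial weighted-centre model `W(f)`.  Instrument — NOT a resolution theorem.
-/
import Literature.AlgebraicGeometry.Resolution.WeightedCentreArcCount
import Literature.AlgebraicGeometry.Resolution.WeightedCentreGradedAutomorphism
import HarnessLib

/-!
# Lemma Q (the face equation): the maximal-rate parts of a centre in inverse normal form act on the face of `h`
# by `h_Δ ∘ θ_Y = h_Δ − [θ = 1/p]·t^p`

[ATW24] Abramovich–Temkin–Włodarczyk, *Functorial embedded resolution via weighted blowings up*, Algebra & Number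
Theory 18 (2024): §3.4 (p. 1570: the valuation ideals `I_m = (x^b | Σ wᵢ bᵢ ≥ m)` and `gr`), Def. 2.4.1 (2) and
Rem. 2.4.2 (p. 1568: admissibility `v_J(f) ≥ 1`, `v_J` of a monomial), Rem. 5.2.3 (p. 1576: `Σ dᵢ/aᵢ ≥ 1` on every
monomial), Lemma 5.2.10 (p. 1577: the initial form under a change of parameters), §5.1 (p. 1575).
[CJS20] Cossart–Jannsen–Saito, *Desingularization: invariants and strategy*, LNM 2270 (2020), Def. 1.26 (restriction
to a coordinate subspace), §2.2 (p. 21: initial forms in `gr`).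

## Setting (polynomial model, `k` a field, variables `Fin N`, NO hypothesis on the characteristic in §§1–4)

As in `WeightedCentreArcCount`: `f = X_a^p + h`, `h` free of `X_a`, a centre with parameters `z` and ambient
coordinates `Y i = Ψ⁻¹ Xᵢ` in inverse normal form (`Y a = X a =: t`, `Y i = X i + t·R i`), so `Ψ⁻¹ f = G := t^p + h(Y)`.
Engine 1's GRADING (E1-PROOF §2.5) gives `t` degree `1` and `ε_i` degree `d_i = w_i/θ`; here it is an arbitrary INTEGER
grading `D : Fin N → ℕ` (think `D = L·(E1's degrees)`), `ord_D = monomialOrd D`, and the weight-`m` layer is Mathlib's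
`weightedHomogeneousComponent D m`.  The **maximal-rate part** of `Y i` is its lowest layer
`θ_Y i := weightedHomogeneousComponent D (D i) (Y i)` (E1: `ε_i + P_i(t, ε)`), meaningful when `Y` DOMINATES `D`:
`D i ≤ ord_D (Y i)` for all `i` (every term `t^s ε^μ` of `Y_i` has degree `≥ d_i`, i.e. rate `≤ ρ* := θ − w_a`,
`le_monomialOrd_of_rate`).  The **face** of `h` is its lowest layer `h₀ := weightedHomogeneousComponent D E₀ h`
(`E₀ ≤ ord_D h`); in E1's θ-grading it is exactly `h_Δ = Σ_{⟨β,w⟩ = 1} h_β ε^β`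
(`coeff_weightedHomogeneousComponent_eq_face`).

## What is proved (all "(derived here)"; the model statements of E1-PROOF §2.5 and §3.2)

* §1 `IsInverseNormalForm.killHom_weightedHomogeneousComponent`: at `t = 0` the maximal-rate parts are the coordinates,
  `(θ_Y i)|_{t=0} = X i|_{t=0}`; hence `killHom_aeval_weightedHomogeneousComponent`: `(P ∘ θ_Y)|_{t=0} = P|_{t=0}`.
* §2 **`IsInverseNormalForm.aeval_weightedHomogeneousComponent_eq` (Lemma Q, homogeneous form).**  Hypotheses: `Y`
  dominates `D`; `E₀ ≤ ord_D h`; and the CONSTRAINED ROWS of degree `E₀` vanish: `coeff d G = 0` for every exponent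
  `d` of `D`-weight `E₀` with `d_a ≥ 1`.  Conclusion: `h₀ ∘ θ_Y = h₀ − [p·D_a = E₀]·t^p`.
  Proof: the degree-`E₀` layer of `G = t^p + h(Y)` is `[p D_a = E₀] t^p + θ_Y(h₀)` (graded-automorphism lemma
  `weightedHomogeneousComponent_map_of_le_monomialOrd` of `WeightedCentreGradedAutomorphism`); by the row hypothesis
  that layer has no monomial through `t`, so it equals its restriction to `t = 0`, which by §1 is `h₀|_{t=0} = h₀`.
  `…_eq_at_one` (Lemma Q at `t = 1`, E1's `h_Δ ∘ ψ = h_Δ − [θ = 1/p]`, `ψ_i = ε_i + P_i(1, ε)`).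
* §3 THE θ-GRADING (E1 §2.5 in integers): `D a = L`, `D_i·θ = L·w_i` (`i ≠ a`), `E₀·θ = L`, `0 < L`.
  `theta_mul_weight` (degree–value identity `θ·deg_D d = L·(v_w(d) + d_a(θ − w_a))`);
  `coeff_eq_zero_of_weight_eq_of_isAdmissibleFor`: if `w_a < θ` and `w` is ADMISSIBLE for `G`, the constrained rows of
  degree `E₀` vanish (such a monomial has value `1 − d_a(θ − w_a) < 1`) — so Lemma Q applies to every admissible centre
  in inverse normal form dominating its θ-grading (`IsInverseNormalForm.face_equation`, `…_at_one`);
  `le_monomialOrd_of_isAdmissibleFor_of_notMem_vars` (`E₀ ≤ ord_D h` from admissibility of `h`);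
  `coeff_weightedHomogeneousComponent_eq_face` (`h₀ = h_Δ`); `le_monomialOrd_of_rate` (domination from the rate bound).
* §4 Worked instance (characteristic `p`, `q = p²`, the Frobenius fold of `WeightedCentreArcCount` §4): `F = X₀^{p²} +
  X₁^p`, `Y = (t, X₁ − t^p)`, `w = (1/(p²+1), 1/p)`, `θ = 1/q` (engine 1's Conjecture T value), `D = (1, p)`, `E₀ = q`:
  all hypotheses of §3 hold, the indicator is `1`, and Lemma Q reads `(X₁ − t^p)^p = X₁^p − t^{q}`.

Value type: typed lemmas in the polynomial `W(f)` model — not a resolution theorem.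
-/

noncomputable section

open MvPolynomial
open Finsupp (weight)

namespace Literature.AlgebraicGeometry.Resolution

namespace WeightedBlowup

variable {k : Type*} [Field k] {N : ℕ}

/-! ## §0 Plumbing -/

/-- A variable absent from `h` has exponent `0` in every monomial of `h` (plumbing). [folklore] -/
private theorem apply_eq_zero_of_notMem_vars₂₇ {h : MvPolynomial (Fin N) k} {a : Fin N} (hh : a ∉ h.vars)
    {β : Fin N →₀ ℕ} (hβ : β ∈ h.support) : β a = 0 := by
  by_contra hne
  exact hh ((mem_vars_iff_mem_support a).mpr ⟨β, hβ, Finsupp.mem_support_iff.mpr hne⟩)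

/-- `weight D d = Σ dᵢ Dᵢ` (plumbing). [folklore] -/
private theorem weight_eq_sum₂₇ (D : Fin N → ℕ) (d : Fin N →₀ ℕ) :
    weight D d = ∑ i ∈ d.support, d i * D i := by
  simp [Finsupp.weight_apply, Finsupp.sum, smul_eq_mul]

/-- A polynomial free of `X_a` is its own restriction to `t = 0` (plumbing). [folklore] -/
private theorem killHom_eq_self_of_notMem_vars₂₇ {a : Fin N} {P : MvPolynomial (Fin N) k} (hP : a ∉ P.vars) :
    killHom {a} P = P := by
  classical
  ext d
  by_cases hd : d a = 0
  · exact coeff_killHom_of_forall_eq_zero (fun x hx => by rw [Finset.mem_singleton.mp hx]; exact hd) P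
  · rw [coeff_killHom_of_ne_zero (Finset.mem_singleton_self a) hd]
    symm
    by_contra hne
    exact hd (apply_eq_zero_of_notMem_vars₂₇ hP (mem_support_iff.mpr hne))

/-- The layers of a polynomial free of `X_a` are free of `X_a` (plumbing). [folklore] -/
private theorem notMem_vars_weightedHomogeneousComponent₂₇ {a : Fin N} {P : MvPolynomial (Fin N) k}
    (hP : a ∉ P.vars) (D : Fin N → ℕ) (m : ℕ) : a ∉ (weightedHomogeneousComponent D m P).vars := by
  classical
  intro ha
  obtain ⟨d, hd, had⟩ := (mem_vars_iff_mem_support a).mp ha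
  rw [mem_support_iff, coeff_weightedHomogeneousComponent] at hd
  split_ifs at hd with hw
  · exact Finsupp.mem_support_iff.mp had (apply_eq_zero_of_notMem_vars₂₇ hP (mem_support_iff.mpr hd))
  · exact hd rfl

/-- Setting `t = c` fixes a polynomial free of `X_a` (plumbing). [folklore] -/
private theorem aeval_ite_eq_self_of_notMem_vars₂₇ (a : Fin N) (c : MvPolynomial (Fin N) k)
    {P : MvPolynomial (Fin N) k} (hP : a ∉ P.vars) :
    aeval (fun j => if j = a then c else X j) P = P := by
  change (aeval _ : MvPolynomial (Fin N) k →ₐ[k] MvPolynomial (Fin N) k).toRingHom P = (RingHom.id _) P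
  refine hom_congr_vars ?_ (fun i hi _ => ?_) rfl
  · ext r
    simp
  · have hia : i ≠ a := fun h => hP (h ▸ hi)
    simp [hia]

/-- The layers of `X_a^p`: `X_a^p` is `D`-homogeneous of degree `p·D_a` (plumbing).
[cite: AbramovichTemkinWlodarczyk2024, Rem. 2.4.2 (p. 1568)] -/
theorem weightedHomogeneousComponent_X_pow (D : Fin N → ℕ) (a : Fin N) (p E : ℕ) :
    weightedHomogeneousComponent D E (X a ^ p : MvPolynomial (Fin N) k) = if p * D a = E then X a ^ p else 0 := by
  classical
  have h : IsWeightedHomogeneous D (X a ^ p : MvPolynomial (Fin N) k) (p * D a) := by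
    have := (isWeightedHomogeneous_X k D a).pow p
    rwa [smul_eq_mul] at this
  rw [weightedHomogeneousComponent_of_mem h]
  by_cases hE : p * D a = E
  · rw [if_pos hE.symm, if_pos hE]
  · rw [if_neg (Ne.symm hE), if_neg hE]

/-- The layers of a multiple of `t = X_a` die at `t = 0` (plumbing). [cite: CossartJannsenSaito2020, Def. 1.26] -/
theorem killHom_weightedHomogeneousComponent_X_mul (D : Fin N → ℕ) (a : Fin N) (n : ℕ)
    (R : MvPolynomial (Fin N) k) : killHom {a} (weightedHomogeneousComponent D n (X a * R)) = 0 := by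
  classical
  ext d
  rw [coeff_zero]
  by_cases hd : d a = 0
  · rw [coeff_killHom_of_forall_eq_zero (fun x hx => by rw [Finset.mem_singleton.mp hx]; exact hd),
      coeff_weightedHomogeneousComponent]
    split_ifs
    · rw [coeff_X_mul', if_neg (Finsupp.notMem_support_iff.mpr hd)]
    · rfl
  · exact coeff_killHom_of_ne_zero (Finset.mem_singleton_self a) hd _

/-! ## §1 The maximal-rate parts `θ_Y i = weightedHomogeneousComponent D (D i) (Y i)` at `t = 0` -/

namespace IsInverseNormalForm

variable {a : Fin N} {Y : Fin N → MvPolynomial (Fin N) k}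

/-- **At `t = 0` the maximal-rate parts are the coordinates**: `(θ_Y i)|_{t=0} = X i|_{t=0}` — for `i ≠ a` the
degree-`D i` layer of `Y i = X i + t·R i` is `X i +` (a multiple of `t`), for `i = a` it is `t`. (derived here)
[cite: CossartJannsenSaito2020, Def. 1.26]; [cite: AbramovichTemkinWlodarczyk2024, §3.4 (p. 1570)] -/
theorem killHom_weightedHomogeneousComponent (hY : IsInverseNormalForm a Y) (D : Fin N → ℕ) (i : Fin N) :
    killHom {a} (weightedHomogeneousComponent D (D i) (Y i)) = if i ∈ ({a} : Finset (Fin N)) then 0 else X i := by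
  classical
  have hX : ∀ j, weightedHomogeneousComponent D (D j) (X j : MvPolynomial (Fin N) k) = X j := fun j =>
    weightedHomogeneousComponent_eq_self (isWeightedHomogeneous_X k D j)
  by_cases hi : i = a
  · subst hi
    rw [hY.1, hX, killHom_X_of_mem (Finset.mem_singleton_self _), if_pos (Finset.mem_singleton_self _)]
  · have hi' : i ∉ ({a} : Finset (Fin N)) := fun h => hi (Finset.mem_singleton.mp h)
    obtain ⟨R, hR⟩ := hY.2 i hi
    rw [hR, map_add, hX, map_add, killHom_weightedHomogeneousComponent_X_mul, add_zero,
      killHom_X_of_not_mem hi', if_neg hi']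

/-- Hence **`(P ∘ θ_Y)|_{t=0} = P|_{t=0}`** for every polynomial `P`. (derived here)
[cite: CossartJannsenSaito2020, Def. 1.26] -/
theorem killHom_aeval_weightedHomogeneousComponent (hY : IsInverseNormalForm a Y) (D : Fin N → ℕ)
    (P : MvPolynomial (Fin N) k) :
    killHom {a} (aeval (fun i => weightedHomogeneousComponent D (D i) (Y i)) P) = killHom {a} P := by
  have hfun : (fun i => killHom {a} (weightedHomogeneousComponent D (D i) (Y i))) =
      fun i => if i ∈ ({a} : Finset (Fin N)) then 0 else X i :=
    funext (hY.killHom_weightedHomogeneousComponent D)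
  rw [comp_aeval_apply, hfun]
  rfl

/-! ## §2 Lemma Q (homogeneous form and at `t = 1`) -/

/-- **LEMMA Q (the face equation, homogeneous `t`-form; E1-PROOF §3.2 in the model).**  Let `Y` be an inverse normal
form relative to `a` dominating the integer grading `D` (`D i ≤ ord_D (Y i)`), `h` free of `X_a` with `E₀ ≤ ord_D h`,
`p ≥ 1`, and suppose the constrained rows of degree `E₀` of `G = X_a^p + h(Y)` vanish: `coeff d G = 0` whenever
`deg_D d = E₀` and `d_a ≥ 1`.  Then, with `θ_Y i :=` the degree-`D i` layer of `Y i` and `h₀ :=` the degree-`E₀` layer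
of `h`:  `h₀(θ_Y) = h₀ − [p·D_a = E₀]·X_a^p`. (derived here)
[cite: AbramovichTemkinWlodarczyk2024, Lemma 5.2.10 (p. 1577), §3.4 (p. 1570)]; [cite: CossartJannsenSaito2020, §2.2 (p. 21)] -/
theorem aeval_weightedHomogeneousComponent_eq (hY : IsInverseNormalForm a Y) (D : Fin N → ℕ)
    (hdom : ∀ i, (D i : ℕ∞) ≤ monomialOrd D (Y i)) {h : MvPolynomial (Fin N) k} (hh : a ∉ h.vars) {E₀ : ℕ}
    (hE : (E₀ : ℕ∞) ≤ monomialOrd D h) {p : ℕ} (hp : 0 < p)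
    (hrows : ∀ d : Fin N →₀ ℕ, weight D d = E₀ → d a ≠ 0 → coeff d (X a ^ p + aeval Y h) = 0) :
    aeval (fun i => weightedHomogeneousComponent D (D i) (Y i)) (weightedHomogeneousComponent D E₀ h) =
      weightedHomogeneousComponent D E₀ h - if p * D a = E₀ then X a ^ p else 0 := by
  classical
  -- (i) the degree-E₀ layer of h(Y) is θ_Y(h₀) (graded-automorphism lemma)
  have h1 : weightedHomogeneousComponent D E₀ (aeval Y h) =
      aeval (fun i => weightedHomogeneousComponent D (D i) (Y i)) (weightedHomogeneousComponent D E₀ h) := by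
    have := weightedHomogeneousComponent_map_of_le_monomialOrd D (aeval Y)
      (fun i => by rw [aeval_X]; exact hdom i) h hE
    simpa only [aeval_X] using this
  -- (ii) the degree-E₀ layer of G
  have h2 : weightedHomogeneousComponent D E₀ (X a ^ p + aeval Y h) = (if p * D a = E₀ then X a ^ p else 0) +
      aeval (fun i => weightedHomogeneousComponent D (D i) (Y i)) (weightedHomogeneousComponent D E₀ h) := by
    rw [map_add, h1, weightedHomogeneousComponent_X_pow]
  -- (iii) that layer has no monomial through t: it equals its restriction to t = 0
  have h3 : killHom {a} (weightedHomogeneousComponent D E₀ (X a ^ p + aeval Y h)) =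
      weightedHomogeneousComponent D E₀ (X a ^ p + aeval Y h) := by
    ext d
    by_cases hd : d a = 0
    · rw [coeff_killHom_of_forall_eq_zero (fun x hx => by rw [Finset.mem_singleton.mp hx]; exact hd)]
    · rw [coeff_killHom_of_ne_zero (Finset.mem_singleton_self a) hd, coeff_weightedHomogeneousComponent]
      split_ifs with hw
      · exact (hrows d hw hd).symm
      · rfl
  -- (iv) and that restriction is h₀
  have h4 : killHom {a} (weightedHomogeneousComponent D E₀ (X a ^ p + aeval Y h)) =
      weightedHomogeneousComponent D E₀ h := by
    rw [h2, map_add, hY.killHom_aeval_weightedHomogeneousComponent D,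
      killHom_eq_self_of_notMem_vars₂₇ (notMem_vars_weightedHomogeneousComponent₂₇ hh D E₀)]
    have hkX : killHom {a} (if p * D a = E₀ then X a ^ p else 0 : MvPolynomial (Fin N) k) = 0 := by
      split_ifs
      · rw [map_pow, killHom_X_of_mem (Finset.mem_singleton_self a), zero_pow hp.ne']
      · exact map_zero _
    rw [hkX, zero_add]
  -- (v) conclude
  have h5 : (if p * D a = E₀ then X a ^ p else 0) +
      aeval (fun i => weightedHomogeneousComponent D (D i) (Y i)) (weightedHomogeneousComponent D E₀ h) =
      weightedHomogeneousComponent D E₀ h := by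
    rw [← h2, ← h3]; exact h4
  rw [eq_sub_iff_add_eq, add_comm]
  exact h5

/-- **LEMMA Q at `t = 1` (E1-PROOF §3.2: `h_Δ ∘ ψ = h_Δ − [θ = 1/p]`, `ψ_i = ε_i + P_i(1, ε)`).**  Under the hypotheses
of `aeval_weightedHomogeneousComponent_eq`, with `ψ i := (θ_Y i)|_{t=1}`:  `h₀(ψ) = h₀ − [p·D_a = E₀]`. (derived here)
[cite: AbramovichTemkinWlodarczyk2024, Lemma 5.2.10 (p. 1577)]; [cite: CossartJannsenSaito2020, §2.2 (p. 21)] -/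
theorem aeval_weightedHomogeneousComponent_eq_at_one (hY : IsInverseNormalForm a Y) (D : Fin N → ℕ)
    (hdom : ∀ i, (D i : ℕ∞) ≤ monomialOrd D (Y i)) {h : MvPolynomial (Fin N) k} (hh : a ∉ h.vars) {E₀ : ℕ}
    (hE : (E₀ : ℕ∞) ≤ monomialOrd D h) {p : ℕ} (hp : 0 < p)
    (hrows : ∀ d : Fin N →₀ ℕ, weight D d = E₀ → d a ≠ 0 → coeff d (X a ^ p + aeval Y h) = 0) :
    aeval (fun i => aeval (fun j => if j = a then (1 : MvPolynomial (Fin N) k) else X j)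
        (weightedHomogeneousComponent D (D i) (Y i))) (weightedHomogeneousComponent D E₀ h) =
      weightedHomogeneousComponent D E₀ h - if p * D a = E₀ then 1 else 0 := by
  have hQ := congrArg (aeval (fun j => if j = a then (1 : MvPolynomial (Fin N) k) else X j))
    (hY.aeval_weightedHomogeneousComponent_eq D hdom hh hE hp hrows)
  rw [comp_aeval_apply, map_sub,
    aeval_ite_eq_self_of_notMem_vars₂₇ a 1 (notMem_vars_weightedHomogeneousComponent₂₇ hh D E₀)] at hQ
  rw [hQ]
  congr 1
  split_ifs
  · rw [map_pow, aeval_X, if_pos rfl, one_pow]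
  · exact map_zero _

end IsInverseNormalForm

/-! ## §3 The θ-grading of E1 §2.5: admissibility kills the constrained rows -/

section Theta

variable {a : Fin N} (w : Fin N → ℚ) (θ : ℚ) (L : ℕ) (D : Fin N → ℕ)

/-- **Degree–value identity of the θ-grading.**  If `D a = L` and `D_i·θ = L·w_i` for `i ≠ a` (E1 §2.5: `deg t = 1`,
`deg ε_i = w_i/θ`, scaled by `L`), then for every exponent `d`:  `θ·deg_D(d) = L·(v_w(d) + d_a·(θ − w_a))`.
(derived here) [cite: AbramovichTemkinWlodarczyk2024, Rem. 2.4.2 (p. 1568), §3.4 (p. 1570)] -/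
theorem theta_mul_weight (hDa : D a = L) (hD : ∀ i, i ≠ a → (D i : ℚ) * θ = L * w i) (d : Fin N →₀ ℕ) :
    θ * (weight D d : ℕ) = L * (monomialValuation w d + d a * (θ - w a)) := by
  classical
  rw [weight_eq_sum₂₇, Nat.cast_sum, Finset.mul_sum, monomialValuation, Finsupp.sum]
  have hterm : ∀ i ∈ d.support, θ * ((d i * D i : ℕ) : ℚ) =
      L * ((d i : ℚ) * w i + if i = a then (d i : ℚ) * (θ - w a) else 0) := by
    intro i _
    by_cases hi : i = a
    · subst hi
      rw [if_pos rfl, hDa]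
      push_cast
      ring
    · rw [if_neg hi, add_zero]
      push_cast
      calc θ * ((d i : ℚ) * D i) = d i * ((D i : ℚ) * θ) := by ring
        _ = d i * (L * w i) := by rw [hD i hi]
        _ = L * (d i * w i) := by ring
  rw [Finset.sum_congr rfl hterm, ← Finset.mul_sum, Finset.sum_add_distrib, Finset.sum_ite_eq']
  congr 2
  split_ifs with ha
  · rfl
  · rw [Finsupp.notMem_support_iff.mp ha, Nat.cast_zero, zero_mul]

/-- **Admissibility kills the constrained rows (E1 §3.2: "every present monomial has degree `≥ E₀` with equality only on
`{t = 0}`").**  In the θ-grading (`D a = L`, `D_i θ = L w_i`, `E₀ θ = L`, `L > 0`) with `w_a < θ` (i.e. `ρ* > 0`), if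
`w` is admissible for `G` then every monomial `d` of degree `E₀` with `d_a ≥ 1` has `coeff d G = 0`: its value would be
`1 − d_a(θ − w_a) < 1`. (derived here) [cite: AbramovichTemkinWlodarczyk2024, Def. 2.4.1 (2) (p. 1568), Rem. 5.2.3 (p. 1576)] -/
theorem coeff_eq_zero_of_weight_eq_of_isAdmissibleFor (hL : 0 < L) (hDa : D a = L)
    (hD : ∀ i, i ≠ a → (D i : ℚ) * θ = L * w i) (hθ : w a < θ) {E₀ : ℕ} (hE₀ : (E₀ : ℚ) * θ = L)
    {G : MvPolynomial (Fin N) k} (hadm : IsAdmissibleFor w G) (d : Fin N →₀ ℕ) (hd : weight D d = E₀)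
    (hda : d a ≠ 0) : coeff d G = 0 := by
  by_contra hne
  have hval : (1 : ℚ) ≤ monomialValuation w d := hadm d (mem_support_iff.mpr hne)
  have hid := theta_mul_weight w θ L D hDa hD d
  rw [hd] at hid
  have hL' : (0 : ℚ) < L := by exact_mod_cast hL
  have h2 : (L : ℚ) * (monomialValuation w d + d a * (θ - w a)) = L * 1 := by
    rw [mul_one, ← hid, mul_comm, hE₀]
  have h1 : monomialValuation w d + d a * (θ - w a) = 1 := mul_left_cancel₀ hL'.ne' h2
  have hda' : (1 : ℚ) ≤ d a := by exact_mod_cast Nat.one_le_iff_ne_zero.mpr hda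
  have : (0 : ℚ) < d a * (θ - w a) := mul_pos (by linarith) (by linarith)
  linarith

/-- **The face is the lowest layer**: in the θ-grading (`θ > 0`), if `h` is free of `X_a` and `w`-admissible then
`E₀ ≤ ord_D h` (a monomial `ε^β` of `h` has degree `L·⟨β,w⟩/θ ≥ L/θ = E₀`). (derived here)
[cite: AbramovichTemkinWlodarczyk2024, Rem. 5.2.3 (p. 1576), §3.4 (p. 1570)] -/
theorem le_monomialOrd_of_isAdmissibleFor_of_notMem_vars (hL : 0 < L) (hDa : D a = L)
    (hD : ∀ i, i ≠ a → (D i : ℚ) * θ = L * w i) (hθ : 0 < θ) {E₀ : ℕ} (hE₀ : (E₀ : ℚ) * θ = L)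
    {h : MvPolynomial (Fin N) k} (hh : a ∉ h.vars) (hadm : IsAdmissibleFor w h) :
    (E₀ : ℕ∞) ≤ monomialOrd D h := by
  rw [le_monomialOrd_iff]
  intro β hβ
  have hβa : β a = 0 := apply_eq_zero_of_notMem_vars₂₇ hh hβ
  have hval : (1 : ℚ) ≤ monomialValuation w β := hadm β hβ
  have hid := theta_mul_weight w θ L D hDa hD β
  rw [hβa, Nat.cast_zero, zero_mul, add_zero] at hid
  have hL' : (0 : ℚ) < L := by exact_mod_cast hL
  have key : (E₀ : ℚ) * θ ≤ (weight D β : ℕ) * θ := by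
    rw [hE₀, mul_comm ((weight D β : ℕ) : ℚ) θ, hid]
    calc (L : ℚ) = L * 1 := (mul_one _).symm
      _ ≤ L * monomialValuation w β := mul_le_mul_of_nonneg_left hval hL'.le
  exact_mod_cast le_of_mul_le_mul_right key hθ

/-- **The lowest layer is the face `h_Δ`**: in the θ-grading (`θ ≠ 0`, `L > 0`), for `h` free of `X_a`,
`coeff β h₀ = [⟨β, w⟩ = 1]·coeff β h`. (derived here) [cite: AbramovichTemkinWlodarczyk2024, Rem. 2.4.2 (p. 1568), §3.4 (p. 1570)] -/
theorem coeff_weightedHomogeneousComponent_eq_face (hL : 0 < L) (hDa : D a = L)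
    (hD : ∀ i, i ≠ a → (D i : ℚ) * θ = L * w i) (hθ : θ ≠ 0) {E₀ : ℕ} (hE₀ : (E₀ : ℚ) * θ = L)
    {h : MvPolynomial (Fin N) k} (hh : a ∉ h.vars) (β : Fin N →₀ ℕ) :
    coeff β (weightedHomogeneousComponent D E₀ h) = if monomialValuation w β = 1 then coeff β h else 0 := by
  classical
  rw [coeff_weightedHomogeneousComponent]
  by_cases hc : coeff β h = 0
  · simp [hc]
  have hβa : β a = 0 := apply_eq_zero_of_notMem_vars₂₇ hh (mem_support_iff.mpr hc)
  have hid := theta_mul_weight w θ L D hDa hD β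
  rw [hβa, Nat.cast_zero, zero_mul, add_zero] at hid
  have hL' : (L : ℚ) ≠ 0 := by exact_mod_cast hL.ne'
  have key : weight D β = E₀ ↔ monomialValuation w β = 1 := by
    constructor
    · intro hw
      rw [hw] at hid
      have h2 : (L : ℚ) * monomialValuation w β = L * 1 := by rw [mul_one, ← hid, mul_comm, hE₀]
      exact mul_left_cancel₀ hL' h2
    · intro hv
      rw [hv, mul_one] at hid
      have h2 : ((weight D β : ℕ) : ℚ) * θ = (E₀ : ℚ) * θ := by rw [mul_comm, hid, hE₀]
      exact_mod_cast mul_right_cancel₀ hθ h2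
  simp only [key]

/-- **Domination from the rate bound (E1 §2.4–2.5: every term has rate `≤ ρ* = θ − w_a`).**  In the θ-grading
(`θ > 0`), if `Y` is an inverse normal form and every monomial `t^s ε^μ` of `Y_i` (`i ≠ a`) satisfies
`w_i ≤ v_w(t^s ε^μ) + s·(θ − w_a)` (i.e. `λ = w_i − s w_a − ⟨μ,w⟩ ≤ s ρ*`), then `Y` dominates `D`. (derived here)
[cite: AbramovichTemkinWlodarczyk2024, §3.4 (p. 1570), Rem. 2.4.2 (p. 1568)] -/
theorem IsInverseNormalForm.le_monomialOrd_of_rate {Y : Fin N → MvPolynomial (Fin N) k}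
    (hY : IsInverseNormalForm a Y) (hDa : D a = L) (hD : ∀ i, i ≠ a → (D i : ℚ) * θ = L * w i) (hθ : 0 < θ)
    (hrate : ∀ i, i ≠ a → ∀ d ∈ (Y i).support, w i ≤ monomialValuation w d + d a * (θ - w a)) (i : Fin N) :
    (D i : ℕ∞) ≤ monomialOrd D (Y i) := by
  classical
  by_cases hi : i = a
  · subst hi
    rw [hY.1, monomialOrd_X]
  · rw [le_monomialOrd_iff]
    intro d hd
    have hid := theta_mul_weight w θ L D hDa hD d
    have h1 : (L : ℚ) * w i ≤ θ * (weight D d : ℕ) := by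
      rw [hid]
      exact mul_le_mul_of_nonneg_left (hrate i hi d hd) (by positivity)
    rw [← hD i hi, mul_comm ((D i : ℕ) : ℚ) θ] at h1
    exact_mod_cast le_of_mul_le_mul_left h1 hθ

/-- **LEMMA Q for an admissible centre (E1-PROOF §3.2 verbatim in the model).**  Let `Y` be an inverse normal form
relative to `a`, `h` free of `X_a`, `p ≥ 1`, `w` ADMISSIBLE for `G = X_a^p + h(Y)`; let `D` be the θ-grading
(`D a = L > 0`, `D_i θ = L w_i`, `E₀ θ = L`) with `w_a < θ`, dominated by `Y`.  Then the face `h₀` (`= h_Δ`) satisfies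
`h₀(θ_Y) = h₀ − [p·L = E₀]·t^p` (`p L = E₀` iff `θ = 1/p`). (derived here)
[cite: AbramovichTemkinWlodarczyk2024, Def. 2.4.1 (2) (p. 1568), Lemma 5.2.10 (p. 1577)]; [cite: CossartJannsenSaito2020, §2.2 (p. 21)] -/
theorem IsInverseNormalForm.face_equation {Y : Fin N → MvPolynomial (Fin N) k} (hY : IsInverseNormalForm a Y)
    (hL : 0 < L) (hDa : D a = L) (hD : ∀ i, i ≠ a → (D i : ℚ) * θ = L * w i) (hθ : w a < θ) (hwa : 0 ≤ w a)
    {E₀ : ℕ} (hE₀ : (E₀ : ℚ) * θ = L) (hdom : ∀ i, (D i : ℕ∞) ≤ monomialOrd D (Y i))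
    {h : MvPolynomial (Fin N) k} (hh : a ∉ h.vars) {p : ℕ} (hp : 0 < p)
    (hadm : IsAdmissibleFor w (X a ^ p + aeval Y h)) :
    aeval (fun i => weightedHomogeneousComponent D (D i) (Y i)) (weightedHomogeneousComponent D E₀ h) =
      weightedHomogeneousComponent D E₀ h - if p * L = E₀ then X a ^ p else 0 := by
  rw [← hDa]
  exact hY.aeval_weightedHomogeneousComponent_eq D hdom hh
    (le_monomialOrd_of_isAdmissibleFor_of_notMem_vars w θ L D hL hDa hD (lt_of_le_of_lt hwa hθ) hE₀ hh
      (hY.isAdmissibleFor_of_aeval hp hh hadm)) hp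
    (coeff_eq_zero_of_weight_eq_of_isAdmissibleFor w θ L D hL hDa hD hθ hE₀ hadm)

/-- **LEMMA Q at `t = 1` for an admissible centre**: `h₀(ψ) = h₀ − [p·L = E₀]`, `ψ_i = (θ_Y i)|_{t=1}`. (derived here)
[cite: AbramovichTemkinWlodarczyk2024, Def. 2.4.1 (2) (p. 1568), Lemma 5.2.10 (p. 1577)]; [cite: CossartJannsenSaito2020, §2.2 (p. 21)] -/
theorem IsInverseNormalForm.face_equation_at_one {Y : Fin N → MvPolynomial (Fin N) k}
    (hY : IsInverseNormalForm a Y) (hL : 0 < L) (hDa : D a = L) (hD : ∀ i, i ≠ a → (D i : ℚ) * θ = L * w i)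
    (hθ : w a < θ) (hwa : 0 ≤ w a) {E₀ : ℕ} (hE₀ : (E₀ : ℚ) * θ = L)
    (hdom : ∀ i, (D i : ℕ∞) ≤ monomialOrd D (Y i)) {h : MvPolynomial (Fin N) k} (hh : a ∉ h.vars) {p : ℕ}
    (hp : 0 < p) (hadm : IsAdmissibleFor w (X a ^ p + aeval Y h)) :
    aeval (fun i => aeval (fun j => if j = a then (1 : MvPolynomial (Fin N) k) else X j)
        (weightedHomogeneousComponent D (D i) (Y i))) (weightedHomogeneousComponent D E₀ h) =
      weightedHomogeneousComponent D E₀ h - if p * L = E₀ then 1 else 0 := by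
  rw [← hDa]
  exact hY.aeval_weightedHomogeneousComponent_eq_at_one D hdom hh
    (le_monomialOrd_of_isAdmissibleFor_of_notMem_vars w θ L D hL hDa hD (lt_of_le_of_lt hwa hθ) hE₀ hh
      (hY.isAdmissibleFor_of_aeval hp hh hadm)) hp
    (coeff_eq_zero_of_weight_eq_of_isAdmissibleFor w θ L D hL hDa hD hθ hE₀ hadm)

end Theta

/-! ## §4 Worked instance: the Frobenius fold at `q = p²`, `θ = 1/q` -/

section Instance

variable (p : ℕ)

/-- `X₀` does not occur in `X₁^p` (plumbing). [folklore] -/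
private theorem notMem_vars_X_pow₂₇ {i j : Fin 2} (hij : i ≠ j) : i ∉ (X j ^ p : MvPolynomial (Fin 2) k).vars :=
  fun h => by
    have := vars_pow (X j : MvPolynomial (Fin 2) k) p h
    rw [vars_X] at this
    exact hij (Finset.mem_singleton.mp this)

variable [hp : Fact p.Prime]

/-- The fold `Y = (t, X₁ − t^p)` dominates the grading `D = (1, p)` (`ord_D(X₁ − t^p) = p`): its one term `−t^p` has
the maximal rate, `v_w(t^p) + p(θ − w₀) = 1/p = w₁` for `w = (1/(p²+1), 1/p)`, `θ = 1/p²`. (derived here)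
[cite: AbramovichTemkinWlodarczyk2024, §3.4 (p. 1570), §5.1 (p. 1575)] -/
theorem le_monomialOrd_fold (i : Fin 2) :
    ((![1, p] : Fin 2 → ℕ) i : ℕ∞) ≤
      monomialOrd ![1, p] ((addPolyShear (1 : Fin 2) (X 0 ^ p : MvPolynomial (Fin 2) k)).symm (X i)) := by
  classical
  have hp0 : (p : ℚ) ≠ 0 := by exact_mod_cast hp.out.ne_zero
  refine (isInverseNormalForm_fold (k := k) p).le_monomialOrd_of_rate ![1 / ((p : ℚ) ^ 2 + 1), 1 / p]
    (1 / (p : ℚ) ^ 2) 1 ![1, p] rfl (fun j hj => ?_) (by positivity) (fun j hj d hd => ?_) i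
  · obtain rfl : j = 1 := by
      rcases Fin.exists_fin_two.mp ⟨j, rfl⟩ with h | h
      · exact absurd h hj
      · exact h
    show ((p : ℕ) : ℚ) * (1 / (p : ℚ) ^ 2) = ((1 : ℕ) : ℚ) * (1 / p)
    field_simp
    ring
  · obtain rfl : j = 1 := by
      rcases Fin.exists_fin_two.mp ⟨j, rfl⟩ with h | h
      · exact absurd h hj
      · exact h
    have hd' : coeff d ((addPolyShear (1 : Fin 2) (X 0 ^ p : MvPolynomial (Fin 2) k)).symm (X 1)) ≠ 0 :=
      mem_support_iff.mp hd
    rw [addPolyShear_symm_X_one_fold, coeff_sub, coeff_X, coeff_X_pow] at hd'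
    have h0 : (![1 / ((p : ℚ) ^ 2 + 1), 1 / p] : Fin 2 → ℚ) 0 = 1 / ((p : ℚ) ^ 2 + 1) := rfl
    have h1 : (![1 / ((p : ℚ) ^ 2 + 1), 1 / p] : Fin 2 → ℚ) 1 = 1 / p := rfl
    by_cases hA : Finsupp.single (1 : Fin 2) 1 = d
    · -- the monomial X₁: value w₁, no t
      subst hA
      rw [monomialValuation, Finsupp.sum_single_index (by rw [Nat.cast_zero, zero_mul]), h1,
        Finsupp.single_eq_of_ne (one_ne_zero' (Fin 2)).symm, Nat.cast_zero, zero_mul, add_zero, Nat.cast_one,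
        one_mul]
    · by_cases hB : Finsupp.single (0 : Fin 2) p = d
      · -- the arc −t^p: value p w₀, s = p: p w₀ + p(θ − w₀) = p θ = 1/p
        subst hB
        rw [monomialValuation, Finsupp.sum_single_index (by rw [Nat.cast_zero, zero_mul]), h0, h1,
          Finsupp.single_eq_same]
        have : (0 : ℚ) < (p : ℚ) ^ 2 + 1 := by positivity
        field_simp
        nlinarith [this]
      · rw [if_neg hA, if_neg hB, sub_zero] at hd'
        exact absurd rfl hd'

variable [CharP k p]

/-- **Lemma Q on the fold (`θ = 1/q`, indicator `1`):** with `D = (1, p)`, `E₀ = q = p²` the maximal-rate parts are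
`θ_Y = (t, X₁ − t^p)` (all of `Y`), the face of `h = X₁^p` is `X₁^p`, and Lemma Q reads
`(X₁ − t^p)^p = X₁^p − t^{p²}` — every hypothesis of `IsInverseNormalForm.face_equation` holds for this admissible
centre with `x`-entry `p² + 1 > q`. (derived here)
[cite: AbramovichTemkinWlodarczyk2024, Def. 2.4.1 (2) (p. 1568), Lemma 5.2.10 (p. 1577)] -/
example :
    aeval (fun i => weightedHomogeneousComponent ![1, p] ((![1, p] : Fin 2 → ℕ) i)
        ((addPolyShear (1 : Fin 2) (X 0 ^ p : MvPolynomial (Fin 2) k)).symm (X i)))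
      (weightedHomogeneousComponent ![1, p] (p ^ 2) (X 1 ^ p : MvPolynomial (Fin 2) k)) =
      weightedHomogeneousComponent ![1, p] (p ^ 2) (X 1 ^ p) - X 0 ^ (p ^ 2) := by
  classical
  have hp0 : (p : ℚ) ≠ 0 := by exact_mod_cast hp.out.ne_zero
  obtain ⟨-, -, hadm⟩ := isCentreFor_fold (k := k) p
  rw [algEquiv_symm_eq_aeval, (isInverseNormalForm_fold p).aeval_X_pow_add] at hadm
  have hQ := (isInverseNormalForm_fold (k := k) p).face_equation ![1 / ((p : ℚ) ^ 2 + 1), 1 / p]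
    (1 / (p : ℚ) ^ 2) 1 ![1, p] one_pos rfl (fun j hj => ?_) ?_
    (by show (0 : ℚ) ≤ 1 / ((p : ℚ) ^ 2 + 1); positivity) (E₀ := p ^ 2) ?_
    (le_monomialOrd_fold p) (notMem_vars_X_pow₂₇ p zero_ne_one) (pow_pos hp.out.pos 2) hadm
  · rw [if_pos (by ring)] at hQ
    exact hQ
  · obtain rfl : j = 1 := by
      rcases Fin.exists_fin_two.mp ⟨j, rfl⟩ with h | h
      · exact absurd h hj
      · exact h
    show ((p : ℕ) : ℚ) * (1 / (p : ℚ) ^ 2) = ((1 : ℕ) : ℚ) * (1 / p)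
    field_simp
    ring
  · show 1 / ((p : ℚ) ^ 2 + 1) < 1 / (p : ℚ) ^ 2
    have : (0 : ℚ) < (p : ℚ) ^ 2 := by positivity
    exact one_div_lt_one_div_of_lt this (by linarith)
  · push_cast
    field_simp

end Instance

end WeightedBlowup

end Literature.AlgebraicGeometry.Resolution
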